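import Mathlib
import HarnessLib

/-!
# `PencilRigidity.ShellRigidity` · line `transverse-smearing-planar-threshold` · stub `stub_fourierVanish`

Fourier modes of a continuous `π/2`-periodic function `g : ℝ → ℂ` admitting, at every depth `Ψ`, a
holomorphic chart `h` on the rectangle `{|Re w| < 3π/8, |Im w| < Ψ}` which agrees with `g` at real
points, takes equal values on the vertical lines `Re w = ±π/4`, and grows at most like
`‖h w‖ ≤ A + B e^{σ|Im w|}` with `σ < 8`: only the modes `e^{4inα}` with `|n| ≤ 1` survive, i.e.
`g = c₀ + c₁ e^{4iα} + c₂ e^{-4iα}`.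

Proof (one complex variable, Mathlib only).
* `FourierVanish.integral_shift`: Cauchy–Goursat on the rectangle `[-π/4, π/4] × [0, ψ]`
  (`Complex.integral_boundary_rect_eq_zero_of_differentiableOn`) moves the coefficient integral
  `∫_{-π/4}^{π/4} e^{-4inx} h(x) dx` to height `ψ`; the vertical sides cancel because the chart values
  agree there and `e^{-4in(π/4 + iy)} = e^{-4in(-π/4 + iy)}` (`e^{2πin} = 1`).
* `FourierVanish.norm_integral_shift_le`: at height `ψ` the integrand is bounded by
  `(A + B e^{σ|ψ|}) e^{4nψ}`.
* `FourierVanish.integral_eq_zero`: for `|n| ≥ 2` send `ψ → ∓∞` (sign opposite to `n`): the bound is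
  `(π/2)(A e^{-4|n|t} + B e^{(σ - 4|n|)t}) → 0` since `σ < 8 ≤ 4|n|`, so the integral vanishes.
* `stub_fourierVanish`: lift `g` to `C(AddCircle (π/2), ℂ)`; its Fourier coefficients are these
  integrals (`fourierCoeff_eq_intervalIntegral`, `fourier_coe_apply`), hence vanish off `{-1, 0, 1}`;
  a finitely supported coefficient sequence is summable, so the Fourier series converges pointwise
  (`has_pointwise_sum_fourier_series_of_summable`) and reduces to its three terms.
-/

noncomputable section

namespace Summit.QuantumFields.YangMills.Cruxes.ShellRigidity.TransverseSmearingPlanarThreshold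

open MeasureTheory Complex Filter Topology Set intervalIntegral

namespace FourierVanish

/-- The phases on the two vertical sides agree: `e^{-4in(π/4 + iy)} = e^{-4in(-π/4 + iy)}`, because
their quotient is `e^{-2πin} = 1`. -/
theorem cexp_side_eq (n : ℤ) (y : ℝ) :
    cexp (-(4 * (n : ℂ) * (((Real.pi / 4 : ℝ) : ℂ) + y * I) * I)) =
      cexp (-(4 * (n : ℂ) * (((-(Real.pi / 4) : ℝ) : ℂ) + y * I) * I)) := by
  refine Complex.exp_eq_exp_iff_exists_int.2 ⟨-n, ?_⟩
  push_cast
  ring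

/-- **Contour shift.** For `h` holomorphic on the rectangle `{|Re w| < 3π/8, |Im w| < Ψ}` with equal
values on the vertical lines `Re w = ±π/4`, the integral of `e^{-4inw} h(w)` over the segment
`[-π/4, π/4]` equals the one over the shifted segment `[-π/4, π/4] + iψ` for every `|ψ| < Ψ`
(Cauchy–Goursat on the rectangle `[-π/4, π/4] × [0, ψ]`; the vertical sides cancel). -/
theorem integral_shift {h : ℂ → ℂ} {Ψ : ℝ}
    (hd : DifferentiableOn ℂ h {w : ℂ | |w.re| < 3 * Real.pi / 8 ∧ |w.im| < Ψ})
    (hside : ∀ y : ℝ, |y| < Ψ →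
      h (((Real.pi / 4 : ℝ) : ℂ) + y * I) = h (((-(Real.pi / 4) : ℝ) : ℂ) + y * I))
    (n : ℤ) {ψ : ℝ} (hψ : |ψ| < Ψ) :
    ∫ x in (-(Real.pi / 4))..(Real.pi / 4), cexp (-(4 * (n : ℂ) * x * I)) * h x =
      ∫ x in (-(Real.pi / 4))..(Real.pi / 4),
        cexp (-(4 * (n : ℂ) * (x + ψ * I) * I)) * h (x + ψ * I) := by
  set G : ℂ → ℂ := fun w => cexp (-(4 * (n : ℂ) * w * I)) * h w with hG
  have he : Differentiable ℂ fun w : ℂ => cexp (-(4 * (n : ℂ) * w * I)) := by fun_prop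
  have hGd : DifferentiableOn ℂ G {w : ℂ | |w.re| < 3 * Real.pi / 8 ∧ |w.im| < Ψ} :=
    he.differentiableOn.mul hd
  have hzre : (((-(Real.pi / 4) : ℝ) : ℂ)).re = -(Real.pi / 4) := ofReal_re _
  have hzim : (((-(Real.pi / 4) : ℝ) : ℂ)).im = 0 := ofReal_im _
  have hwre : (((Real.pi / 4 : ℝ) : ℂ) + ψ * I).re = Real.pi / 4 := by simp
  have hwim : (((Real.pi / 4 : ℝ) : ℂ) + ψ * I).im = ψ := by simp
  have hπ4 : -(Real.pi / 4) ≤ Real.pi / 4 := by linarith [Real.pi_pos]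
  -- Cauchy–Goursat on the closed rectangle, which lies inside the chart
  have hC := Complex.integral_boundary_rect_eq_zero_of_differentiableOn G
    ((-(Real.pi / 4) : ℝ) : ℂ) (((Real.pi / 4 : ℝ) : ℂ) + ψ * I) (hGd.mono (by
      rw [hzre, hzim, hwre, hwim]
      intro u hu
      rw [mem_reProdIm, uIcc_of_le hπ4, mem_Icc] at hu
      obtain ⟨⟨h1, h2⟩, h3⟩ := hu
      refine ⟨?_, ?_⟩
      · rw [abs_lt]; constructor <;> linarith [Real.pi_pos]
      · have := abs_sub_left_of_mem_uIcc h3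
        rw [sub_zero, sub_zero] at this
        exact lt_of_le_of_lt this hψ))
  rw [hzre, hzim, hwre, hwim] at hC
  -- the vertical sides cancel
  have hvert : (∫ y : ℝ in (0 : ℝ)..ψ, G (((Real.pi / 4 : ℝ) : ℂ) + y * I)) =
      ∫ y : ℝ in (0 : ℝ)..ψ, G (((-(Real.pi / 4) : ℝ) : ℂ) + y * I) := by
    refine intervalIntegral.integral_congr fun y hy => ?_
    have hy' : |y| < Ψ := by
      have := abs_sub_left_of_mem_uIcc hy
      rw [sub_zero, sub_zero] at this
      exact lt_of_le_of_lt this hψ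
    simp only [hG]
    rw [cexp_side_eq n y, hside y hy']
  rw [hvert, add_sub_cancel_right, sub_eq_zero] at hC
  -- the bottom side is the original integral
  have hbot : (∫ x : ℝ in (-(Real.pi / 4))..(Real.pi / 4), G (x + (0 : ℝ) * I)) =
      ∫ x : ℝ in (-(Real.pi / 4))..(Real.pi / 4), G x :=
    intervalIntegral.integral_congr fun x _ => by simp
  rw [hbot] at hC
  simpa only [hG] using hC

/-- **The shifted integral is exponentially bounded.** If `‖h w‖ ≤ A + B e^{σ|Im w|}` on the chart
rectangle, then `‖∫_{-π/4}^{π/4} e^{-4in(x+iψ)} h(x+iψ) dx‖ ≤ (A + B e^{σ|ψ|}) e^{4nψ} · (π/2)` for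
`|ψ| < Ψ` (`‖e^{-4in(x+iψ)}‖ = e^{4nψ}`). -/
theorem norm_integral_shift_le {h : ℂ → ℂ} {Ψ σ A B : ℝ}
    (hb : ∀ w : ℂ, |w.re| < 3 * Real.pi / 8 → |w.im| < Ψ → ‖h w‖ ≤ A + B * Real.exp (σ * |w.im|))
    (n : ℤ) {ψ : ℝ} (hψ : |ψ| < Ψ) :
    ‖∫ x in (-(Real.pi / 4))..(Real.pi / 4),
        cexp (-(4 * (n : ℂ) * (x + ψ * I) * I)) * h (x + ψ * I)‖ ≤
      (A + B * Real.exp (σ * |ψ|)) * Real.exp (4 * n * ψ) * (Real.pi / 2) := by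
  have hπ4 : -(Real.pi / 4) ≤ Real.pi / 4 := by linarith [Real.pi_pos]
  have key := intervalIntegral.norm_integral_le_of_norm_le_const (a := -(Real.pi / 4))
    (b := Real.pi / 4) (C := (A + B * Real.exp (σ * |ψ|)) * Real.exp (4 * n * ψ))
    (f := fun x : ℝ => cexp (-(4 * (n : ℂ) * (x + ψ * I) * I)) * h (x + ψ * I)) (by
      intro x hx
      rw [uIoc_of_le hπ4] at hx
      have hxre : ((x : ℂ) + ψ * I).re = x := by simp
      have hxim : ((x : ℂ) + ψ * I).im = ψ := by simp
      have habs : |x| < 3 * Real.pi / 8 := by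
        rw [abs_lt]; constructor <;> linarith [hx.1, hx.2, Real.pi_pos]
      rw [norm_mul, Complex.norm_exp]
      have hre : (-(4 * (n : ℂ) * (x + ψ * I) * I)).re = 4 * n * ψ := by
        simp
      rw [hre, mul_comm]
      refine mul_le_mul_of_nonneg_right ?_ (Real.exp_pos _).le
      have := hb (x + ψ * I) (by rw [hxre]; exact habs) (by rw [hxim]; exact hψ)
      rwa [hxim] at this)
  have hlen : |Real.pi / 4 - -(Real.pi / 4)| = Real.pi / 2 := by
    rw [abs_of_nonneg (by linarith [Real.pi_pos])]; ring
  rwa [hlen] at key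

/-- **Vanishing of the high modes.** Under the hypotheses of `stub_fourierVanish` (charts at every
depth with equal values on `Re w = ±π/4` and growth of exponential type `σ < 8`), the coefficient
integral `∫_{-π/4}^{π/4} e^{-4inx} g(x) dx` vanishes for every `|n| ≥ 2`: by `integral_shift` and
`norm_integral_shift_le` its norm is at most `(π/2)(A + B e^{σt}) e^{-4|n|t}` for every `t > 0`
(height `ψ = ∓t`), and this tends to `0` as `t → ∞` because `σ < 8 ≤ 4|n|`. -/
theorem integral_eq_zero (g : ℝ → ℂ) (σ A B : ℝ) (hσ8 : σ < 8)
    (hcharts : ∀ Ψ : ℝ, 0 < Ψ → ∃ h : ℂ → ℂ,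
      DifferentiableOn ℂ h {w : ℂ | |w.re| < 3 * Real.pi / 8 ∧ |w.im| < Ψ} ∧
      (∀ α : ℝ, |α| < 3 * Real.pi / 8 → h α = g α) ∧
      (∀ y : ℝ, |y| < Ψ →
        h (((Real.pi / 4 : ℝ) : ℂ) + y * I) = h (((-(Real.pi / 4) : ℝ) : ℂ) + y * I)) ∧
      (∀ w : ℂ, |w.re| < 3 * Real.pi / 8 → |w.im| < Ψ → ‖h w‖ ≤ A + B * Real.exp (σ * |w.im|)))
    (n : ℤ) (hn : 2 ≤ |n|) :
    ∫ x in (-(Real.pi / 4))..(Real.pi / 4), cexp (-(4 * (n : ℂ) * x * I)) * g x = 0 := by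
  set J := ∫ x in (-(Real.pi / 4))..(Real.pi / 4), cexp (-(4 * (n : ℂ) * x * I)) * g x with hJ
  -- Step 1: the estimate at an arbitrary height `ψ`
  have hest : ∀ ψ : ℝ,
      ‖J‖ ≤ (A + B * Real.exp (σ * |ψ|)) * Real.exp (4 * n * ψ) * (Real.pi / 2) := by
    intro ψ
    obtain ⟨h, hd, hreal, hside, hb⟩ := hcharts (|ψ| + 1) (by positivity)
    have hψ : |ψ| < |ψ| + 1 := lt_add_one _
    have hJ' : J = ∫ x in (-(Real.pi / 4))..(Real.pi / 4), cexp (-(4 * (n : ℂ) * x * I)) * h x := by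
      refine intervalIntegral.integral_congr fun x hx => ?_
      rw [uIcc_of_le (by linarith [Real.pi_pos]), mem_Icc] at hx
      rw [hreal x (by rw [abs_lt]; constructor <;> linarith [Real.pi_pos])]
    rw [hJ', integral_shift hd hside n hψ]
    exact norm_integral_shift_le hb n hψ
  -- Step 2: a bound `(A + B e^{σt}) e^{-ct} (π/2)` for all `t > 0`, with `σ < c` and `0 < c`,
  -- forces `J = 0`
  have key : ∀ c : ℝ, σ < c → 0 < c →
      (∀ t : ℝ, 0 < t →
        ‖J‖ ≤ (A + B * Real.exp (σ * t)) * Real.exp (-(c * t)) * (Real.pi / 2)) → J = 0 := by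
    intro c hσc hc hJle
    have h1 : Tendsto (fun t : ℝ => Real.exp (-c * t)) atTop (𝓝 0) :=
      Real.tendsto_exp_comp_nhds_zero.2 (tendsto_id.const_mul_atTop_of_neg (by linarith))
    have h2 : Tendsto (fun t : ℝ => Real.exp ((σ - c) * t)) atTop (𝓝 0) :=
      Real.tendsto_exp_comp_nhds_zero.2 (tendsto_id.const_mul_atTop_of_neg (by linarith))
    have h3 := ((h1.const_mul A).add (h2.const_mul B)).mul_const (Real.pi / 2)
    rw [mul_zero, mul_zero, add_zero, zero_mul] at h3
    have hlim : Tendsto (fun t : ℝ =>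
        (A + B * Real.exp (σ * t)) * Real.exp (-(c * t)) * (Real.pi / 2)) atTop (𝓝 0) := by
      refine h3.congr' (Eventually.of_forall fun t => ?_)
      have e : (σ - c) * t = σ * t + -(c * t) := by ring
      simp only
      rw [e, Real.exp_add, neg_mul]
      ring
    have hle : ‖J‖ ≤ 0 :=
      ge_of_tendsto hlim ((eventually_gt_atTop 0).mono fun t ht => hJle t ht)
    exact norm_le_zero_iff.1 hle
  have hn' : (2 : ℝ) ≤ |(n : ℝ)| := by
    rw [← Int.cast_abs]; exact_mod_cast hn
  rcases le_abs'.1 hn with hneg | hpos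
  · -- `n ≤ -2`: heights `ψ = t → +∞`
    have hnr : (n : ℝ) ≤ -2 := by exact_mod_cast hneg
    refine key (-(4 * n)) (by linarith) (by linarith) fun t ht => ?_
    have := hest t
    rwa [abs_of_pos ht, show (4 * (n : ℝ) * t) = -(-(4 * n) * t) by ring] at this
  · -- `2 ≤ n`: heights `ψ = -t → -∞`
    have hnr : (2 : ℝ) ≤ n := by exact_mod_cast hpos
    refine key (4 * n) (by linarith) (by linarith) fun t ht => ?_
    have := hest (-t)
    rwa [abs_neg, abs_of_pos ht, show (4 * (n : ℝ) * -t) = -(4 * n * t) by ring] at this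

end FourierVanish

/-- **Stub · Fourier modes of a `π/2`-periodic function with charts of exponential type `< 8`**
(M/L; second half of the lead's stub 7, one complex variable). `g` continuous and `π/2`-periodic; for
every depth `Ψ > 0` a function `h` holomorphic on the rectangle `{|Re w| < 3π/8, |Im w| < Ψ}`, equal to
`g` at its real points, with EQUAL VALUES on the two vertical lines `Re w = ±π/4`, and
`‖h w‖ ≤ A + B e^{σ|Im w|}` with `σ < 8` (`A`, `B` independent of `Ψ`). Then the Fourier coefficients
`ĝ(n) = (2/π) ∫_{-π/4}^{π/4} g e^{-4inα}` vanish for `|n| ≥ 2`: Cauchy on the rectangle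
`[-π/4, π/4] × [0, ψ]` (`Complex.integral_boundary_rect_eq_zero_of_differentiableOn`; the vertical sides
cancel since `e^{-4in(±π/4)} = (-1)^n`) moves the integral to height `ψ`, where it is
`≤ (A + B e^{σ|ψ|}) e^{4nψ} → 0` as `ψ → ∓∞`; and a continuous function on `AddCircle (π/2)` with finitely
many nonzero coefficients is its Fourier polynomial (`hasSum_fourier_series_of_summable`,
`fourierCoeff_eq_intervalIntegral`). -/
theorem stub_fourierVanish (g : ℝ → ℂ) (hg : Continuous g) (hper : Function.Periodic g (Real.pi / 2))
    (σ A B : ℝ) (hσ8 : σ < 8)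
    (hcharts : ∀ Ψ : ℝ, 0 < Ψ → ∃ h : ℂ → ℂ,
      DifferentiableOn ℂ h {w : ℂ | |w.re| < 3 * Real.pi / 8 ∧ |w.im| < Ψ} ∧
      (∀ α : ℝ, |α| < 3 * Real.pi / 8 → h α = g α) ∧
      (∀ y : ℝ, |y| < Ψ → h (((Real.pi / 4 : ℝ) : ℂ) + y * I) = h (((-(Real.pi / 4) : ℝ) : ℂ) + y * I)) ∧
      (∀ w : ℂ, |w.re| < 3 * Real.pi / 8 → |w.im| < Ψ → ‖h w‖ ≤ A + B * Real.exp (σ * |w.im|))) :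
    ∃ c₀ c₁ c₂ : ℂ, ∀ x : ℝ,
      g x = c₀ + c₁ * cexp (4 * (x : ℂ) * I) + c₂ * cexp (-(4 * (x : ℂ) * I)) := by
  haveI : Fact (0 < Real.pi / 2) := ⟨by positivity⟩
  -- the lift of `g` to the circle of length `π/2`
  have hcont : Continuous (hper.lift : AddCircle (Real.pi / 2) → ℂ) := by
    have h : (hper.lift : AddCircle (Real.pi / 2) → ℂ) ∘
        (QuotientAddGroup.mk : ℝ → AddCircle (Real.pi / 2)) = g := by
      funext x; exact hper.lift_coe x
    rw [(QuotientAddGroup.isQuotientMap_mk _).continuous_iff, h]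
    exact hg
  set gT : C(AddCircle (Real.pi / 2), ℂ) := ⟨hper.lift, hcont⟩ with hgT
  have hgT_coe : ∀ x : ℝ, gT (x : AddCircle (Real.pi / 2)) = g x := fun x => hper.lift_coe x
  have hπ : (Real.pi : ℂ) ≠ 0 := ofReal_ne_zero.2 Real.pi_ne_zero
  -- its Fourier coefficients are the coefficient integrals over `[-π/4, π/4]`
  have hcoeff : ∀ n : ℤ, fourierCoeff gT n = ((1 / (Real.pi / 2) : ℝ) : ℂ) *
      ∫ x in (-(Real.pi / 4))..(Real.pi / 4), cexp (-(4 * (n : ℂ) * x * I)) * g x := by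
    intro n
    rw [fourierCoeff_eq_intervalIntegral gT n (-(Real.pi / 4)), ← Complex.real_smul,
      show -(Real.pi / 4) + Real.pi / 2 = Real.pi / 4 by ring]
    congr 1
    refine intervalIntegral.integral_congr fun x _ => ?_
    simp only [fourier_coe_apply, smul_eq_mul, hgT_coe]
    congr 2
    push_cast
    field_simp
    ring
  -- the high modes vanish
  have hzero : ∀ n : ℤ, n ∉ ({-1, 0, 1} : Finset ℤ) → fourierCoeff gT n = 0 := by
    intro n hn
    have hn2 : 2 ≤ |n| := by
      simp only [Finset.mem_insert, Finset.mem_singleton, not_or] at hn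
      rcases abs_cases n with ⟨h, _⟩ | ⟨h, _⟩ <;> omega
    rw [hcoeff n, FourierVanish.integral_eq_zero g σ A B hσ8 hcharts n hn2, mul_zero]
  have hsum : Summable (fourierCoeff gT) := summable_of_ne_finset_zero hzero
  refine ⟨fourierCoeff gT 0, fourierCoeff gT 1, fourierCoeff gT (-1), fun x => ?_⟩
  have h1 := has_pointwise_sum_fourier_series_of_summable hsum (x : AddCircle (Real.pi / 2))
  have h2 : HasSum (fun i : ℤ => fourierCoeff gT i • fourier i (x : AddCircle (Real.pi / 2)))
      (∑ i ∈ ({-1, 0, 1} : Finset ℤ),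
        fourierCoeff gT i • fourier i (x : AddCircle (Real.pi / 2))) :=
    hasSum_sum_of_ne_finset_zero fun i hi => by simp only [hzero i hi, zero_smul]
  have h3 := h1.unique h2
  rw [hgT_coe] at h3
  rw [h3, Finset.sum_insert (by decide), Finset.sum_insert (by decide), Finset.sum_singleton]
  simp only [smul_eq_mul]
  rw [fourier_coe_apply, fourier_coe_apply, fourier_coe_apply]
  have e1 : 2 * (Real.pi : ℂ) * I * ((1 : ℤ) : ℂ) * (x : ℂ) / ((Real.pi / 2 : ℝ) : ℂ) =
      4 * (x : ℂ) * I := by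
    push_cast; field_simp; ring
  have e2 : 2 * (Real.pi : ℂ) * I * ((-1 : ℤ) : ℂ) * (x : ℂ) / ((Real.pi / 2 : ℝ) : ℂ) =
      -(4 * (x : ℂ) * I) := by
    push_cast; field_simp; ring
  have e0 : 2 * (Real.pi : ℂ) * I * ((0 : ℤ) : ℂ) * (x : ℂ) / ((Real.pi / 2 : ℝ) : ℂ) = 0 := by
    push_cast; ring
  rw [e1, e2, e0, Complex.exp_zero]
  ring

end Summit.QuantumFields.YangMills.Cruxes.ShellRigidity.TransverseSmearingPlanarThreshold
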